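/-
COR-CM (cell pub-hodgecm2, stage 2 of the Hodge ladder) — count-neutral KERNEL COMBINATORICS «the octic product column G = Q₈ × B, D₄ × B: equivariance of the
residual functionals under the central y» (seat prover-pub-hodgecm2-b23-g45-0, binder prover b23, gen 45; own census lane OCTIC-PRODUCT, claim HOME/INBOX.md l.18829).
Theorems only — the `y`-entries of gen 44ʼs `Census/QuarticInversion{Equivariance,Values}.lean` for the motion `twZ` of the CENTRAL `y` (no reversal: same coset
permutation `σY`, same mask `bY ζ`, same pattern maps `pY ζ`/`qY ζ`, but the SLOT IS KEPT), on those files BY NAME; no `decide` beyond closed identities in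
`Bool`/`ZMod 2`/`Fin 4`, no certificate, no named fact, no `sorry`.  `Interfaces.lean` (C1), every E term, B01, `Transposition/*`, `PortJoin/*`, `D2Bridge/*` untouched.
HONEST FRAMING: `HC_CM` is NOT proved, here or anywhere in the tree; nothing here is a period, a count of record or a headline.
T5: n/a-class (no hypothesis binders beyond `Odd |B|`); checker: self, 2026-08-24.
-/
import Summits.HodgeConjecture.CorCM.Census.QuarticInversionValues
import Summits.HodgeConjecture.CorCM.Census.OcticProductModel

/-!
# The octic product column: the residual functionals under the central `y`

Gen 44ʼs residual functionals of the `(Ty B)⁴` model (`Census/QuarticInversionFunctionals.lean`: the pair-odd functional `fnl w`, the atom weights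
`wA j η s`, the constant weights `wC η`, the up-indicator `wUp j s`; `Census/QuarticInversionValues.lean`: the value vector `Avec`, the slot binomials
`binVec j h h' u`) are label-level; what depends on the group is how they transform under the motions.  For the octic product column the motions of `H₀`
and `t` are gen 44ʼs, and this file supplies the entries for the motion `twZ ζ` of the CENTRAL `y` (`Census/OcticProductModel.lean`):
* §1 `fnl w (y·v) = fnl (w ∘ twZ ζ) v`; `coord n (twZ ζ Θ) = coord (σY n) Θ + [bY ζ n]·𝟙` and the halves move by `σY` with flips on `bY ζ` — exactly the
  shape of gen 44ʼs `t`-entries (`coord_twT`, `half_coord_twT`) with `(σT, bT)` replaced by `(σY, bY ζ)`, and of its `y`-entries WITHOUT the reversal of `B`;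
* §2 the moved weights `wUp_twZ`, `wA_twZ` (pattern map `pY ζ`, slot KEPT), `wC_twZ`; the values on `y`-translates `fnl_wA_translZ`, `fnl_wC_translZ`;
* §3 **transport of slot binomials by the central `y`** (`Avec_translZ_of_binVec`): `Avec (y·v) = binVec (σY j) (qY ζ h) (qY ζ h') u` off the mask,
  patterns complemented-and-swapped on it — gen 44ʼs `Avec_translY_of_binVec` with the slot `u` in place of `−u`.
All [folklore] (bookkeeping in Pohlmannʼs model [Pohlmann1968, Thm 1]).

## References
* [Pohlmann1968] H. Pohlmann, Algebraic cycles on abelian varieties of complex multiplication type, Ann. of Math. 88 (1968), Thm 1.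
-/

namespace Summit.HodgeConjecture.CorCM.Census.OcticProduct

open Finset
open Summit.HodgeConjecture.CorCM.Census.OddSliceFacesModel
open Summit.HodgeConjecture.CorCM.Census.QuarticInversion

noncomputable section

variable (A : Type) [AddCommGroup A] [Fintype A] [DecidableEq A]

/-! ## §1 Functionals, coordinates and halves under the central `y` -/

/-- **`fnl w (y·v) = fnl (w ∘ y) v`** for the central `y`. [folklore] -/
theorem fnl_translZ (ζ : ZMod 2) (w v : Ty₄ A → ℤ) : fnl A w (translZ A ζ v) = fnl A (w ∘ twZ A ζ) v := by
  rw [fnl_apply, fnl_apply]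
  refine Fintype.sum_equiv (twZEquiv A ζ).symm _ _ fun Θ => ?_
  show v (twZinv A ζ Θ) * (w Θ - w (conj₄ A Θ)) =
    v (twZinv A ζ Θ) * (w (twZ A ζ (twZinv A ζ Θ)) - w (twZ A ζ (conj₄ A (twZinv A ζ Θ))))
  rw [twZ_conj₄, twZ_twZinv]

omit [AddCommGroup A] [Fintype A] [DecidableEq A] in
/-- **Coordinates of `y·Θ`** (central `y`): `coord n (twZ ζ Θ) = coord (σY n) Θ + [bY ζ n]·𝟙` — NO reversal. [folklore] -/
theorem coord_twZ (ζ : ZMod 2) (Θ : Ty₄ A) (n : Fin 4) :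
    coord A n (twZ A ζ Θ) = coord A (σY n) Θ + (if bY ζ n then 1 else 0) := by
  obtain ⟨⟨ψ₀, ψ₁⟩, ⟨ψ₂, ψ₃⟩⟩ := Θ
  have h01 : ∀ u : ZMod 2, u = 0 ∨ u = 1 := by decide
  rcases h01 ζ with rfl | rfl <;> fin_cases n <;>
    simp [coord, twZ, twV, σY, bY]

omit [AddCommGroup A] [DecidableEq A] in
/-- **Halves of `y·Θ`** (central `y`): permuted by `σY`, flipped on the mask `bY ζ`. [folklore] -/
theorem half_coord_twZ (hA : Odd (Fintype.card A)) (ζ : ZMod 2) (Θ : Ty₄ A) (n : Fin 4) :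
    half A (coord A n (twZ A ζ Θ)) = xor (half A (coord A (σY n) Θ)) (bY ζ n) := by
  rw [coord_twZ, half_add_ite A hA]

/-! ## §2 The moved weights and the values on `y`-translates -/

omit [AddCommGroup A] [DecidableEq A] in
/-- **`wUp` after the central `y`**: coordinate `σY j`, SAME slot; conjugate on the mask. [folklore] -/
theorem wUp_twZ (hA : Odd (Fintype.card A)) (ζ : ZMod 2) (j : Fin 4) (s : A) (Θ : Ty₄ A) :
    wUp A j s (twZ A ζ Θ) = if bY ζ j then wUp A (σY j) s (conj₄ A Θ) else wUp A (σY j) s Θ := by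
  have h01 : ∀ u : ZMod 2, u = 0 ∨ u = 1 := by decide
  have h11 : (1 : ZMod 2) + 1 = 0 := by decide
  cases hb : bY ζ j
  · rw [if_neg (by decide)]
    unfold wUp
    rw [half_coord_twZ A hA, coord_twZ, hb]
    simp
  · rw [if_pos rfl, wUp_conj₄ A hA]
    unfold wUp
    rw [half_coord_twZ A hA, coord_twZ, hb]
    simp only [if_true, Bool.xor_true, Pi.add_apply, Pi.one_apply]
    rcases h01 (coord A (σY j) Θ s) with h | h <;> cases half A (coord A (σY j) Θ) <;> simp [h, h11]

omit [AddCommGroup A] [DecidableEq A] in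
/-- **The atom weight moved by the central `y`**: `wA j η s (y·Θ) = wA (σY j) (pY ζ η) s Θ` off the mask `bY ζ`, `= wA (σY j) (!pY ζ η) s Θ̄` on it
(slot kept). [folklore] -/
theorem wA_twZ (hA : Odd (Fintype.card A)) (ζ : ZMod 2) (j : Fin 4) (η : Fin 4 → Bool) (s : A) (Θ : Ty₄ A) :
    wA A j η s (twZ A ζ Θ) = if bY ζ j then wA A (σY j) (fun n => !pY ζ η n) s (conj₄ A Θ) else wA A (σY j) (pY ζ η) s Θ := by
  have hm := wMatch_of_perm A (σ := σY) σY_σY (bY ζ) (Θ := Θ) (Θ' := twZ A ζ Θ) (fun n => half_coord_twZ A hA ζ Θ n) j η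
  unfold wA
  rw [hm, wUp_twZ A hA]
  cases bY ζ j
  · rw [if_neg (by decide), if_neg (by decide)]; rfl
  · rw [if_pos rfl, if_pos rfl, wMatch_conj₄ A hA]
    simp only [Bool.not_not]; rfl

omit [AddCommGroup A] [DecidableEq A] in
/-- **The constant weight moved by the central `y`.** [folklore] -/
theorem wC_twZ (hA : Odd (Fintype.card A)) (ζ : ZMod 2) (η : Fin 4 → Bool) (Θ : Ty₄ A) : wC A η (twZ A ζ Θ) = wC A (pY ζ η) Θ :=
  wC_of_perm A (σ := σY) σY_σY (bY ζ) (fun n => half_coord_twZ A hA ζ Θ n) η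

/-- **Atom values on a `y`-translate** (central `y`). [folklore] -/
theorem fnl_wA_translZ (hA : Odd (Fintype.card A)) (ζ : ZMod 2) (j : Fin 4) (η : Fin 4 → Bool) (s : A) (v : Ty₄ A → ℤ) :
    fnl A (wA A j η s) (translZ A ζ v) =
      if bY ζ j then -fnl A (wA A (σY j) (fun n => !pY ζ η n) s) v else fnl A (wA A (σY j) (pY ζ η) s) v := by
  rw [fnl_translZ]
  cases hb : bY ζ j
  · have hw : (wA A j η s ∘ twZ A ζ) = wA A (σY j) (pY ζ η) s := by
      funext Θ; simp only [Function.comp, wA_twZ A hA, hb]; rfl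
    rw [if_neg (by decide), hw]
  · have hw : (wA A j η s ∘ twZ A ζ) = (wA A (σY j) (fun n => !pY ζ η n) s ∘ conj₄ A) := by
      funext Θ; simp only [Function.comp, wA_twZ A hA, hb, if_true]
    rw [if_pos rfl, hw, fnl_comp_conj₄]

/-- **Constant values on a `y`-translate** (central `y`). [folklore] -/
theorem fnl_wC_translZ (hA : Odd (Fintype.card A)) (ζ : ZMod 2) (η : Fin 4 → Bool) (v : Ty₄ A → ℤ) :
    fnl A (wC A η) (translZ A ζ v) = fnl A (wC A (pY ζ η)) v := by
  have hw : (wC A η ∘ twZ A ζ) = wC A (pY ζ η) := by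
    funext Θ; simp only [Function.comp, wC_twZ A hA]
  rw [fnl_translZ, hw]

/-- **`fnl (wUp j s) (y·v) = ± fnl (wUp (σY j) s) v`** (central `y`). [folklore] -/
theorem fnl_wUp_translZ (hA : Odd (Fintype.card A)) (ζ : ZMod 2) (j : Fin 4) (s : A) (v : Ty₄ A → ℤ) :
    fnl A (wUp A j s) (translZ A ζ v) = (if bY ζ j then -1 else 1) * fnl A (wUp A (σY j) s) v := by
  rw [fnl_translZ]
  cases hb : bY ζ j
  · have hw : (wUp A j s ∘ twZ A ζ) = wUp A (σY j) s := by funext Θ; simp only [Function.comp, wUp_twZ A hA, hb]; rfl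
    rw [hw]; simp
  · have hw : (wUp A j s ∘ twZ A ζ) = (wUp A (σY j) s ∘ conj₄ A) := by
      funext Θ; simp only [Function.comp, wUp_twZ A hA, hb, if_true]
    rw [hw, fnl_comp_conj₄]; simp

/-! ## §3 Transport of slot binomials by the central `y` -/

/-- **Transport by the central `y`**: coordinate `σY j`, SAME slot, patterns moved by `qY ζ` (complemented and swapped on the mask). [folklore] -/
theorem Avec_translZ_of_binVec (hA : Odd (Fintype.card A)) (ζ : ZMod 2) {v : Ty₄ A → ℤ} {j : Fin 4} {h h' : Fin 4 → Bool} {u : A}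
    (hv : Avec A v = binVec A j h h' u) :
    Avec A (translZ A ζ v) =
      if bY ζ (σY j) then binVec A (σY j) (qY ζ (fun n => !h' n)) (qY ζ (fun n => !h n)) u
      else binVec A (σY j) (qY ζ h) (qY ζ h') u := by
  funext i
  rcases i with ⟨j', η, s⟩ | η
  · rw [Avec_inl, fnl_wA_translZ A hA]
    have hj : (σY j' = j) ↔ (j' = σY j) := by
      constructor
      · intro e; rw [← e, σY_σY]
      · intro e; rw [e, σY_σY]
    by_cases hb : bY ζ j' = true
    · rw [if_pos hb, ← Avec_inl, hv, binVec_inl]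
      by_cases hc : σY j' = j ∧ s = u
      · obtain ⟨hc1, hc2⟩ := hc
        have hb' : bY ζ (σY j) = true := by rw [← hc1, σY_σY]; exact hb
        rw [if_pos ⟨hc1, hc2⟩, if_pos hb', binVec_inl, if_pos ⟨hj.mp hc1, hc2⟩, ← hc1]
        show -(ind₁ (σY j') h (fun n => !pY ζ η n) - ind₁ (σY j') h' (fun n => !pY ζ η n)) = _
        unfold pY
        rw [ind₁_perm_not σY_σY, ind₁_perm_not σY_σY, σY_σY]
        show -(ind₁ j' (qY ζ fun n => !h n) η - ind₁ j' (qY ζ fun n => !h' n) η) = _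
        ring
      · rw [if_neg hc, neg_zero]
        have hc' : ¬ (j' = σY j ∧ s = u) := fun ⟨e1, e2⟩ => hc ⟨hj.mpr e1, e2⟩
        split_ifs with hb'
        · rw [binVec_inl, if_neg hc']
        · rw [binVec_inl, if_neg hc']
    · rw [if_neg hb, ← Avec_inl, hv, binVec_inl]
      by_cases hc : σY j' = j ∧ s = u
      · obtain ⟨hc1, hc2⟩ := hc
        have hb' : ¬ bY ζ (σY j) = true := by rw [← hc1, σY_σY]; exact hb
        rw [if_pos ⟨hc1, hc2⟩, if_neg hb', binVec_inl, if_pos ⟨hj.mp hc1, hc2⟩, ← hc1]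
        unfold pY
        rw [ind₁_perm σY_σY, ind₁_perm σY_σY, σY_σY]
        rfl
      · rw [if_neg hc]
        have hc' : ¬ (j' = σY j ∧ s = u) := fun ⟨e1, e2⟩ => hc ⟨hj.mpr e1, e2⟩
        split_ifs with hb'
        · rw [binVec_inl, if_neg hc']
        · rw [binVec_inl, if_neg hc']
  · rw [Avec_inr, fnl_wC_translZ A hA, ← Avec_inr, hv, binVec_inr]
    split_ifs <;> rw [binVec_inr]

end

end Summit.HodgeConjecture.CorCM.Census.OcticProduct
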